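import Mathlib
import HarnessLib
import Summits.HubbardSuperconductivity.HubbardSuperconductivity.Theorems.KLProgrammeKLRegimeWickDressedStep
import Summits.HubbardSuperconductivity.HubbardSuperconductivity.Theorems.KLProgrammeKLRegimeWickStepLines

/-!
# Route `KLProgramme` — ENGINE child gen 8 (stmt-HubbardSuperconductivity-20437 `KLRegimeEngineV17F2`), skeleton v2 class #5 «(S)-transfer» (plan g17 (R47h)):
# the SMEARED STEP — `e^{Δ_D}𝒱_{n+1} = e^{Δ_{D + g_{n+1}}}𝒱_n − ½·dblFold((e^{Δ_×(g)} − 1)e^{Δ_×(D)}(W⁰W¹)) + e^{Δ_D}R₃` for ANY kept covariance `D`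

Cell gate-hubbard-kl, seat hubbard-kl-p1 (g11; text owner of class #5).  Class #5 carries the family `D ↦ 𝒱₄(e^{Δ_D}𝒱_n[K])` over the admissible soft
sub-covariances `D` of the frame (`PairTransferFamilyCov`, draft `…EngineV8PairTransferExport`, HOME/p1 sha16 40db61e5…; KL STATUS 14:46:56Z (q6′)): its
member `D = D_n` is the WICK amplitude the tower runs on, `D = 0` the PLAIN amplitude of the slot, and the step `n → n+1` maps the scale-`(n+1)` member at `D`
to the scale-`n` member at the GAPPED covariance `D + g_{n+1}` — the producer never un-smears (no tadpole of an inherited sextic is read).  The identity behind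
that statement, for an ARBITRARY kept covariance `D` (the generic `wickStep_cross`, p524233, at `g := g_{n+1}`, `V := 𝒱_n`, plus the semigroup
`klw_effectiveAction_succ`):

* **`klw_smearedAction_succ`** — `e^{Δ_D}𝒱_{n+1} = e^{Δ_{D+g_{n+1}}}𝒱_n − ½·dblFold((e^{Δ_×(g_{n+1})} − 1)(e^{Δ_×(D)}(W⁰·W¹))) + e^{Δ_D}R₃(g_{n+1}, 𝒱_n)`,
  `W = e^{Δ_{D+g_{n+1}}}𝒱_n` (`D = D_{n+1}`: `klw_wickAction_succ_cross`; `D = 0`: the plain step with its first-order term inside `e^{Δ_g}𝒱_n`);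
* **`klw_vertexFn_smearedAction_succ`** — the same read by any vertex function; **`klw_vertexFn_smearedAction_succ_lines`** — with the two-copy operator expanded in
  the number of lines, `(e^{Δ_×(g)} − 1)e^{Δ_×(D)} = Σ_{j<|Γ|+2}(j!)⁻¹(Δ_×(D+g)^j − Δ_×(D)^j)` (`gaussConv_sub_gaussConv_eq_sum_pow`, p504266): `j = 1` the one-line term
  (leg dressing; its `D′`-tadpole is `vertexFn_tadpole_dblFold_crossLaplacian`, p538407), `j = 2` the bubbles with line pairs `(D+g)⊗(D+g) − D⊗D = g⊗g + g⊗D + D⊗g`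
  (`vertexFnW_dblFold_bubble_pairLabels/_general` with diagonal lines), `j ≥ 3` the E.5 classes.

So the scale-`(n+1)` family member at `D` is: [scale-`n` member at `D + g_{n+1}`] − ½[two-copy terms whose vertices `W` have pair kernel = that same scale-`n`
member] + [third order].  Exact algebra; nothing about sizes or superconductivity is asserted.  0 kit.
-/

noncomputable section

namespace Summit.HubbardSuperconductivity.HubbardSuperconductivity.Theorems.KLRegimeWick

set_option linter.dupNamespace false -- summit = problem name (single-conjunct summit), D-0017

open Literature.MathematicalPhysics.QuantumLattice GrassmannAlgebra Finset Matrix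
open Literature.Probability.LatticeModels Summit.HubbardSuperconductivity.HubbardSuperconductivity.Theorems.KLProgrammeLegKernels
open Summit.HubbardSuperconductivity.HubbardSuperconductivity.Theorems.KLRegimeSplit
open scoped Nat

section Model

variable (L M : ℕ) [NeZero L] [NeZero M] (β U μ : ℝ) (K : TrigPolyC4v)

omit [NeZero M] in
/-- **`klw_smearedAction_succ` — the smeared step for ANY kept covariance `D`.**  With `g = g_{n+1}` and `W = e^{Δ_{D+g}}𝒱_n`:
`e^{Δ_D}𝒱_{n+1} = e^{Δ_{D+g}}𝒱_n − ½·dblFold((e^{Δ_×(g)} − 1)(e^{Δ_×(D)}(W⁰·W¹))) + e^{Δ_D}R₃`,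
`R₃ = effAction g 𝒱_n − e^{Δ_g}𝒱_n + ½(e^{Δ_g}(𝒱_n·𝒱_n) − (e^{Δ_g}𝒱_n)²)` (needs `Z_n ≠ 0`). -/
theorem klw_smearedAction_succ (n : ℕ) (hZ : klStepPartitionFn L M β U μ K n ≠ 0) (D : Matrix (HubbardFieldIdx L M) (HubbardFieldIdx L M) ℂ) :
    gaussConv ℂ D (klEffectiveAction L M β U μ K klE0 (n + 1)) =
      gaussConv ℂ (D + klSliceCov L M β μ K (n + 1)) (klEffectiveAction L M β U μ K klE0 n) -
        (2 : ℂ)⁻¹ • dblFold ℂ ((gaussConv ℂ (crossCov ℂ (klSliceCov L M β μ K (n + 1))) - 1)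
          (gaussConv ℂ (crossCov ℂ D)
            (dblCopy ℂ 0 (gaussConv ℂ (D + klSliceCov L M β μ K (n + 1)) (klEffectiveAction L M β U μ K klE0 n)) *
              dblCopy ℂ 1 (gaussConv ℂ (D + klSliceCov L M β μ K (n + 1)) (klEffectiveAction L M β U μ K klE0 n))))) +
        gaussConv ℂ D (effAction ℂ (klSliceCov L M β μ K (n + 1)) (klEffectiveAction L M β U μ K klE0 n) -
            gaussConv ℂ (klSliceCov L M β μ K (n + 1)) (klEffectiveAction L M β U μ K klE0 n) +
          (2 : ℂ)⁻¹ • (gaussConv ℂ (klSliceCov L M β μ K (n + 1)) (klEffectiveAction L M β U μ K klE0 n * klEffectiveAction L M β U μ K klE0 n) -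
            gaussConv ℂ (klSliceCov L M β μ K (n + 1)) (klEffectiveAction L M β U μ K klE0 n) *
              gaussConv ℂ (klSliceCov L M β μ K (n + 1)) (klEffectiveAction L M β U μ K klE0 n))) := by
  rw [klw_effectiveAction_succ L M β U μ K n hZ]
  exact wickStep_cross (klSliceCov L M β μ K (n + 1)) D (klw_effectiveAction_mem_evenOdd_zero L M β U μ K n)

omit [NeZero L] [NeZero M] in
/-- Vertex functions are linear: scalars. -/
theorem klw_vertexFn_smul (c : ℂ) (G : HubbardGrassmann L M) (m : ℕ) (X : Fin m → HubbardFieldIdx L M) :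
    vertexFn L M β (c • G) m X = c * vertexFn L M β G m X := by
  rw [vertexFn_def, vertexFn_def, kernel_smul]; ring

omit [NeZero M] in
/-- **`klw_vertexFn_smearedAction_succ`** — the smeared step read by any vertex function at any legs. -/
theorem klw_vertexFn_smearedAction_succ (n : ℕ) (hZ : klStepPartitionFn L M β U μ K n ≠ 0) (D : Matrix (HubbardFieldIdx L M) (HubbardFieldIdx L M) ℂ)
    (m : ℕ) (Z : Fin m → HubbardFieldIdx L M) :
    vertexFn L M β (gaussConv ℂ D (klEffectiveAction L M β U μ K klE0 (n + 1))) m Z =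
      vertexFn L M β (gaussConv ℂ (D + klSliceCov L M β μ K (n + 1)) (klEffectiveAction L M β U μ K klE0 n)) m Z -
        (2 : ℂ)⁻¹ * vertexFn L M β (dblFold ℂ ((gaussConv ℂ (crossCov ℂ (klSliceCov L M β μ K (n + 1))) - 1)
          (gaussConv ℂ (crossCov ℂ D)
            (dblCopy ℂ 0 (gaussConv ℂ (D + klSliceCov L M β μ K (n + 1)) (klEffectiveAction L M β U μ K klE0 n)) *
              dblCopy ℂ 1 (gaussConv ℂ (D + klSliceCov L M β μ K (n + 1)) (klEffectiveAction L M β U μ K klE0 n)))))) m Z +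
        vertexFn L M β (gaussConv ℂ D (effAction ℂ (klSliceCov L M β μ K (n + 1)) (klEffectiveAction L M β U μ K klE0 n) -
            gaussConv ℂ (klSliceCov L M β μ K (n + 1)) (klEffectiveAction L M β U μ K klE0 n) +
          (2 : ℂ)⁻¹ • (gaussConv ℂ (klSliceCov L M β μ K (n + 1)) (klEffectiveAction L M β U μ K klE0 n * klEffectiveAction L M β U μ K klE0 n) -
            gaussConv ℂ (klSliceCov L M β μ K (n + 1)) (klEffectiveAction L M β U μ K klE0 n) *
              gaussConv ℂ (klSliceCov L M β μ K (n + 1)) (klEffectiveAction L M β U μ K klE0 n)))) m Z := by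
  rw [klw_smearedAction_succ L M β U μ K n hZ D, vertexFn_add, klw_vertexFn_sub, klw_vertexFn_smul]

omit [NeZero M] in
/-- **`klw_smearedAction_succ_lines`** — the smeared step with the two-copy operator organised by the NUMBER OF LINES:
`e^{Δ_D}𝒱_{n+1} = e^{Δ_{D+g}}𝒱_n − ½·dblFold(Σ_{j<N}(j!)⁻¹(Δ_×(D+g)^j − Δ_×(D)^j)(W⁰W¹)) + e^{Δ_D}R₃`, `W = e^{Δ_{D+g}}𝒱_n`, `g = g_{n+1}`,
`N = |HubbardFieldIdx × Fin 2| + 2` (`gaussConv_cross_sub_one_apply` + `gaussConv_sub_gaussConv_eq_sum_pow`, p504266): line pairs of the `j = 2` term are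
`(D+g)⊗(D+g) − D⊗D = g⊗g + g⊗D + D⊗g` — the rung with the kept covariance `D` as the softer partner. -/
theorem klw_smearedAction_succ_lines (n : ℕ) (hZ : klStepPartitionFn L M β U μ K n ≠ 0) (D : Matrix (HubbardFieldIdx L M) (HubbardFieldIdx L M) ℂ) :
    gaussConv ℂ D (klEffectiveAction L M β U μ K klE0 (n + 1)) =
      gaussConv ℂ (D + klSliceCov L M β μ K (n + 1)) (klEffectiveAction L M β U μ K klE0 n) -
        (2 : ℂ)⁻¹ • dblFold ℂ (∑ j ∈ Finset.range (Fintype.card (HubbardFieldIdx L M × Fin 2) + 2), ((j ! : ℚ)⁻¹) •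
          ((grassmannLaplacian ℂ (crossCov ℂ (D + klSliceCov L M β μ K (n + 1))) ^ j)
              (dblCopy ℂ 0 (gaussConv ℂ (D + klSliceCov L M β μ K (n + 1)) (klEffectiveAction L M β U μ K klE0 n)) *
                dblCopy ℂ 1 (gaussConv ℂ (D + klSliceCov L M β μ K (n + 1)) (klEffectiveAction L M β U μ K klE0 n))) -
            (grassmannLaplacian ℂ (crossCov ℂ D) ^ j)
              (dblCopy ℂ 0 (gaussConv ℂ (D + klSliceCov L M β μ K (n + 1)) (klEffectiveAction L M β U μ K klE0 n)) *
                dblCopy ℂ 1 (gaussConv ℂ (D + klSliceCov L M β μ K (n + 1)) (klEffectiveAction L M β U μ K klE0 n))))) +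
        gaussConv ℂ D (effAction ℂ (klSliceCov L M β μ K (n + 1)) (klEffectiveAction L M β U μ K klE0 n) -
            gaussConv ℂ (klSliceCov L M β μ K (n + 1)) (klEffectiveAction L M β U μ K klE0 n) +
          (2 : ℂ)⁻¹ • (gaussConv ℂ (klSliceCov L M β μ K (n + 1)) (klEffectiveAction L M β U μ K klE0 n * klEffectiveAction L M β U μ K klE0 n) -
            gaussConv ℂ (klSliceCov L M β μ K (n + 1)) (klEffectiveAction L M β U μ K klE0 n) *
              gaussConv ℂ (klSliceCov L M β μ K (n + 1)) (klEffectiveAction L M β U μ K klE0 n))) := by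
  rw [klw_smearedAction_succ L M β U μ K n hZ D, gaussConv_cross_sub_one_apply, gaussConv_sub_gaussConv_eq_sum_pow]

omit [NeZero M] in
/-- **The family is closed under the step up to second order**: the scale-`(n+1)` member at a kept covariance `D` minus the scale-`n` member at the GAPPED
covariance `D + g_{n+1}`, read by any vertex function, is `−½`(the two-copy line expansion on `W = e^{Δ_{D+g}}𝒱_n`) `+` (third order) — no term reads
`𝒱_n` through a self-contraction (E2-GRIDPOINT-NOTE §5 / (q6′): the producer of class #5 never un-smears). -/
theorem klw_vertexFn_smearedAction_succ_sub (n : ℕ) (hZ : klStepPartitionFn L M β U μ K n ≠ 0) (D : Matrix (HubbardFieldIdx L M) (HubbardFieldIdx L M) ℂ)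
    (m : ℕ) (Z : Fin m → HubbardFieldIdx L M) :
    vertexFn L M β (gaussConv ℂ D (klEffectiveAction L M β U μ K klE0 (n + 1))) m Z -
        vertexFn L M β (gaussConv ℂ (D + klSliceCov L M β μ K (n + 1)) (klEffectiveAction L M β U μ K klE0 n)) m Z =
      -(2 : ℂ)⁻¹ * vertexFn L M β (dblFold ℂ (∑ j ∈ Finset.range (Fintype.card (HubbardFieldIdx L M × Fin 2) + 2), ((j ! : ℚ)⁻¹) •
          ((grassmannLaplacian ℂ (crossCov ℂ (D + klSliceCov L M β μ K (n + 1))) ^ j)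
              (dblCopy ℂ 0 (gaussConv ℂ (D + klSliceCov L M β μ K (n + 1)) (klEffectiveAction L M β U μ K klE0 n)) *
                dblCopy ℂ 1 (gaussConv ℂ (D + klSliceCov L M β μ K (n + 1)) (klEffectiveAction L M β U μ K klE0 n))) -
            (grassmannLaplacian ℂ (crossCov ℂ D) ^ j)
              (dblCopy ℂ 0 (gaussConv ℂ (D + klSliceCov L M β μ K (n + 1)) (klEffectiveAction L M β U μ K klE0 n)) *
                dblCopy ℂ 1 (gaussConv ℂ (D + klSliceCov L M β μ K (n + 1)) (klEffectiveAction L M β U μ K klE0 n)))))) m Z +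
        vertexFn L M β (gaussConv ℂ D (effAction ℂ (klSliceCov L M β μ K (n + 1)) (klEffectiveAction L M β U μ K klE0 n) -
            gaussConv ℂ (klSliceCov L M β μ K (n + 1)) (klEffectiveAction L M β U μ K klE0 n) +
          (2 : ℂ)⁻¹ • (gaussConv ℂ (klSliceCov L M β μ K (n + 1)) (klEffectiveAction L M β U μ K klE0 n * klEffectiveAction L M β U μ K klE0 n) -
            gaussConv ℂ (klSliceCov L M β μ K (n + 1)) (klEffectiveAction L M β U μ K klE0 n) *
              gaussConv ℂ (klSliceCov L M β μ K (n + 1)) (klEffectiveAction L M β U μ K klE0 n)))) m Z := by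
  rw [klw_smearedAction_succ_lines L M β U μ K n hZ D, vertexFn_add, klw_vertexFn_sub, klw_vertexFn_smul]
  ring

end Model

end Summit.HubbardSuperconductivity.HubbardSuperconductivity.Theorems.KLRegimeWick

end
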